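import Literature.Topology.FourManifolds.SliceDiscExteriorHomology
import HarnessLib

/-!
# The exterior of a topologically flat slice disc is a homology circle

Topic `Literature/Topology/FourManifolds`; a sibling of `SliceDiscExteriorHomology.lean` (the
same statement for *smooth* slice discs `Knot.IsSliceDisc`), written for the topological half of
the Fox–Milnor programme (the named fact
`Literature.Topology.FourManifolds.exists_eq_mul_invert_of_isTopologicallySlice`,
`SliceKnots.lean`): every route to the metabolizer of the Seifert form of a *topologically* slice
knot starts from the homology of the flat-disc exterior `B̊⁴ ∖ Δ` (`H₁ ≅ ℤ` generated by a
meridian, `Hᵢ = 0` for `i ≥ 2`: the circle-valued map / infinite cyclic cover of the exterior;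
Livingston (2005), §2 Thm. 2.6 and §6; Kauffman (1987), Ch. VIII Thm. 8.2).

The argument of `SliceDiscExteriorHomology.lean` (Manolescu–Piccirillo 2023, proof of Lemma 3.3,
with Hatcher's Prop. 2B.1(b)) uses of the slice disc `g : ℝ² → ℝ⁴` only that it is continuous and
injective on the closed disc `𝔻²`, maps the open disc into the open ball and the unit circle into
the unit sphere.  We record it in that generality:

* `exists_isEmbedding_sphere_two_homeomorph_of_continuousOn` — for such a `g` the open exterior
  `sliceDiscExterior g = B̊⁴ ∖ g(𝔻²)` is homeomorphic to the complement of a topologically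
  embedded `2`-sphere in `S⁴` (one-point compactification of the proper injection `B̊² → B̊⁴`);
* `isZero_singularHomology_sliceDiscExterior_of_continuousOn`,
  `nonempty_singularHomology_sliceDiscExterior_one_iso_of_continuousOn` — hence
  `Hᵢ(B̊⁴ ∖ g(𝔻²); M) = 0` for `i ≥ 2` and `H₁(B̊⁴ ∖ g(𝔻²); M) ≅ M` (Hatcher, Prop. 2B.1(b):
  `SphereComplement.isZero_compl_range_of_isEmbedding_holds`,
  `SphereComplement.nonempty_compl_range_iso_coeff_of_isEmbedding`);

and specialise to the core `x ↦ F (x, 0)` of the product neighbourhood `F : ℝ² × ℝ² → ℝ⁴` of a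
flat disc as in `Literature.Topology.FourManifolds.Knot.IsTopologicallySlice`
(`SliceRibbon.lean`):

* `TopFlatDisc.continuousOn_core`, `TopFlatDisc.injOn_core`, `TopFlatDisc.norm_core_lt_one`,
  `TopFlatDisc.norm_core_eq_one` — the core of a flat disc is a continuous injective proper disc;
* `TopFlatDisc.isZero_singularHomology_sliceDiscExterior`,
  `TopFlatDisc.nonempty_singularHomology_sliceDiscExterior_one_iso` — **the exterior of a flat
  disc is a homology circle**;
* `Knot.IsTopologicallySlice.exists_core_homologyCircle` — the same from
  `K.IsTopologicallySlice`.

Everything is proved; no definitions, no notation, no named facts.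

## References

* A. Hatcher, *Algebraic Topology*, CUP 2002, Prop. 2B.1(b). [HatcherAT2002]
* C. Livingston, *A survey of classical knot concordance*, Handbook of Knot Theory (2005), §2
  (Thm. 2.6) and §6. [Livingston2005]
* M. H. Freedman, F. Quinn, *Topology of 4-manifolds* (1990), §9.3 (flat = locally flat with a
  normal bundle). [FreedmanQuinn1990]
* C. Manolescu, L. Piccirillo, J. Lond. Math. Soc. 108 (2023), §3.2, proof of Lemma 3.3 (the
  compactification trick, smooth case). [ManolescuPiccirillo2023]
-/

noncomputable section

open Set Function Metric Filter Topology CategoryTheory Limits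
open Literature.AlgebraicTopology.SingularHomology

namespace Literature.Topology.FourManifolds

/-! ### Continuous proper injective discs -/

section ProperDisc

variable {g : EuclideanSpace ℝ (Fin 2) → EuclideanSpace ℝ (Fin 4)}

/-- A continuous disc sending the open disc into the open ball and the circle into the sphere
sends the closed disc into the closed ball. [folklore] -/
theorem norm_le_one_of_norm_lt_one_of_norm_eq_one
    (hlt : ∀ x : EuclideanSpace ℝ (Fin 2), ‖x‖ < 1 → ‖g x‖ < 1)
    (heq : ∀ x : EuclideanSpace ℝ (Fin 2), ‖x‖ = 1 → ‖g x‖ = 1)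
    {x : EuclideanSpace ℝ (Fin 2)} (hx : ‖x‖ ≤ 1) : ‖g x‖ ≤ 1 := by
  rcases hx.lt_or_eq with h | h
  · exact (hlt x h).le
  · exact (heq x h).le

/-- **Properness of a continuous proper disc**: the part of the closed disc mapped into the closed
ball of radius `ρ < 1` is a compact subset of the *open* disc. [folklore] -/
theorem isCompact_norm_le_of_continuousOn
    (hc : ContinuousOn g (Metric.closedBall (0 : EuclideanSpace ℝ (Fin 2)) 1))
    (heq : ∀ x : EuclideanSpace ℝ (Fin 2), ‖x‖ = 1 → ‖g x‖ = 1) {ρ : ℝ} (hρ : ρ < 1) :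
    IsCompact {x : EuclideanSpace ℝ (Fin 2) | ‖x‖ ≤ 1 ∧ ‖g x‖ ≤ ρ} ∧
      {x : EuclideanSpace ℝ (Fin 2) | ‖x‖ ≤ 1 ∧ ‖g x‖ ≤ ρ} ⊆ Metric.ball 0 1 := by
  constructor
  · have hset : {x : EuclideanSpace ℝ (Fin 2) | ‖x‖ ≤ 1 ∧ ‖g x‖ ≤ ρ} =
        Metric.closedBall (0 : EuclideanSpace ℝ (Fin 2)) 1 ∩ (fun x ↦ ‖g x‖) ⁻¹' Iic ρ := by
      ext x
      simp
    rw [hset]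
    exact (isCompact_closedBall (0 : EuclideanSpace ℝ (Fin 2)) 1).of_isClosed_subset
      ((continuous_norm.comp_continuousOn hc).preimage_isClosed_of_isClosed isClosed_closedBall
        isClosed_Iic) inter_subset_left
  · intro x hx
    rw [mem_ball_zero_iff]
    rcases hx.1.lt_or_eq with h | h
    · exact h
    · exact absurd (heq x h) (by linarith [hx.2])

/-- **A continuous proper injective disc closes up to an embedded `2`-sphere in `S⁴` whose
complement is the open disc exterior.**  Let `g : ℝ² → ℝ⁴` be continuous and injective on the
closed unit disc, map the open disc into the open unit ball and the unit circle into the unit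
sphere.  Then there is a topological embedding `h : S² → S⁴` with
`sliceDiscExterior g ≃ₜ S⁴ ∖ h(S²)`: `h` is the extension to the one-point compactifications
`OnePoint ℝ² ≅ S²`, `OnePoint ℝ⁴ ≅ S⁴` of the proper injection `u ↦ β₄⁻¹ (g (β₂ u))`,
`β : ℝⁿ ≃ₜ B̊ⁿ` (the argument of Manolescu–Piccirillo 2023, proof of Lemma 3.3, written there for
smooth slice discs: `Knot.IsSliceDisc.exists_isEmbedding_sphere_two_homeomorph`).
[cite: ManolescuPiccirillo2023, §3.2, proof of Lemma 3.3] -/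
theorem exists_isEmbedding_sphere_two_homeomorph_of_continuousOn
    (hc : ContinuousOn g (Metric.closedBall (0 : EuclideanSpace ℝ (Fin 2)) 1))
    (hinj : InjOn g (Metric.closedBall (0 : EuclideanSpace ℝ (Fin 2)) 1))
    (hlt : ∀ x : EuclideanSpace ℝ (Fin 2), ‖x‖ < 1 → ‖g x‖ < 1)
    (heq : ∀ x : EuclideanSpace ℝ (Fin 2), ‖x‖ = 1 → ‖g x‖ = 1) :
    ∃ h : Metric.sphere (0 : EuclideanSpace ℝ (Fin 3)) 1 →
        Metric.sphere (0 : EuclideanSpace ℝ (Fin 5)) 1,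
      IsEmbedding h ∧ Nonempty (sliceDiscExterior g ≃ₜ ↥((range h)ᶜ)) := by
  -- the homeomorphisms `ℝⁿ ≃ₜ B̊ⁿ` and `OnePoint ℝⁿ ≃ₜ Sⁿ`
  set β₂ : EuclideanSpace ℝ (Fin 2) ≃ₜ ↥(Metric.ball (0 : EuclideanSpace ℝ (Fin 2)) 1) :=
    Homeomorph.unitBall with hβ₂
  set β₄ : EuclideanSpace ℝ (Fin 4) ≃ₜ ↥(Metric.ball (0 : EuclideanSpace ℝ (Fin 4)) 1) :=
    Homeomorph.unitBall with hβ₄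
  let e₂ : OnePoint (EuclideanSpace ℝ (Fin 2)) ≃ₜ
      Metric.sphere (0 : EuclideanSpace ℝ (Fin 3)) 1 :=
    onePointEquivSphereOfFinrankEq (by simp)
  let e₄ : OnePoint (EuclideanSpace ℝ (Fin 4)) ≃ₜ
      Metric.sphere (0 : EuclideanSpace ℝ (Fin 5)) 1 :=
    onePointEquivSphereOfFinrankEq (by simp)
  -- the proper injection `G u = β₄⁻¹ (g (β₂ u))`
  have hball : ∀ u : EuclideanSpace ℝ (Fin 2), g (β₂ u : EuclideanSpace ℝ (Fin 2)) ∈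
      Metric.ball (0 : EuclideanSpace ℝ (Fin 4)) 1 := fun u =>
    mem_ball_zero_iff.2 (hlt _ (mem_ball_zero_iff.1 (β₂ u).2))
  let G : EuclideanSpace ℝ (Fin 2) → EuclideanSpace ℝ (Fin 4) := fun u =>
    β₄.symm ⟨g (β₂ u), hball u⟩
  have hgc : Continuous fun u : EuclideanSpace ℝ (Fin 2) =>
      g (β₂ u : EuclideanSpace ℝ (Fin 2)) :=
    hc.comp_continuous (continuous_subtype_val.comp β₂.continuous)
      fun u => ball_subset_closedBall (β₂ u).2
  have hGc : Continuous G := β₄.symm.continuous.comp (hgc.subtype_mk _)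
  have hGinj : Injective G := by
    intro u v huv
    have h1 : (⟨g (β₂ u), hball u⟩ : ↥(Metric.ball (0 : EuclideanSpace ℝ (Fin 4)) 1)) =
        ⟨g (β₂ v), hball v⟩ := β₄.symm.injective huv
    have h2 : g (β₂ u) = g (β₂ v) := congrArg Subtype.val h1
    have h3 : (β₂ u : EuclideanSpace ℝ (Fin 2)) = β₂ v :=
      hinj (ball_subset_closedBall (β₂ u).2) (ball_subset_closedBall (β₂ v).2) h2
    exact β₂.injective (Subtype.ext h3)
  -- properness: `G ⁻¹' T` is relatively compact for `T` compact
  have hGproper : Tendsto G (cocompact _) (cocompact _) := by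
    rw [hasBasis_cocompact.tendsto_right_iff]
    intro T hT
    set T' : Set (EuclideanSpace ℝ (Fin 4)) := Subtype.val '' (β₄ '' T) with hT'
    have hT'c : IsCompact T' := (hT.image β₄.continuous).image continuous_subtype_val
    have hT'b : T' ⊆ Metric.ball 0 1 := by
      rintro _ ⟨y, -, rfl⟩
      exact y.2
    obtain ⟨ρ, hρ1, hρ⟩ : ∃ ρ : ℝ, ρ < 1 ∧ ∀ y ∈ T', ‖y‖ ≤ ρ := by
      rcases T'.eq_empty_or_nonempty with h0 | hne
      · exact ⟨0, zero_lt_one, fun y hy => by simp [h0] at hy⟩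
      · obtain ⟨y₀, hy₀, hmax⟩ := hT'c.exists_isMaxOn hne continuous_norm.continuousOn
        exact ⟨‖y₀‖, mem_ball_zero_iff.1 (hT'b hy₀), fun y hy => hmax hy⟩
    obtain ⟨hSc, hSb⟩ := isCompact_norm_le_of_continuousOn hc heq hρ1
    set S : Set ↥(Metric.ball (0 : EuclideanSpace ℝ (Fin 2)) 1) :=
      Subtype.val ⁻¹' {x : EuclideanSpace ℝ (Fin 2) | ‖x‖ ≤ 1 ∧ ‖g x‖ ≤ ρ} with hS
    have hS' : IsCompact S := by
      rw [IsEmbedding.subtypeVal.isCompact_iff, hS, image_preimage_eq_inter_range,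
        Subtype.range_coe, inter_eq_left.2 hSb]
      exact hSc
    refine Filter.mem_cocompact.2 ⟨β₂ ⁻¹' S, β₂.isCompact_preimage.2 hS', fun u hu => ?_⟩
    change G u ∉ T
    intro hGu
    apply hu
    have h1 : (⟨g (β₂ u), hball u⟩ : ↥(Metric.ball (0 : EuclideanSpace ℝ (Fin 4)) 1)) ∈
        β₄ '' T :=
      ⟨G u, hGu, β₄.apply_symm_apply _⟩
    have h2 : g (β₂ u) ∈ T' := ⟨_, h1, rfl⟩
    exact ⟨(mem_ball_zero_iff.1 (β₂ u).2).le, hρ _ h2⟩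
  have hGtend : Tendsto G (coclosedCompact _) (coclosedCompact _) := by
    rwa [Filter.coclosedCompact_eq_cocompact, Filter.coclosedCompact_eq_cocompact]
  -- the embedding `h = e₄ ∘ OnePoint.map G ∘ e₂⁻¹`
  let h : Metric.sphere (0 : EuclideanSpace ℝ (Fin 3)) 1 →
      Metric.sphere (0 : EuclideanSpace ℝ (Fin 5)) 1 :=
    fun s => e₄ (OnePoint.map G (e₂.symm s))
  have hhc : Continuous h :=
    e₄.continuous.comp ((OnePoint.continuous_map hGc hGtend).comp e₂.symm.continuous)
  have hmapinj : Injective (OnePoint.map G) := Option.map_injective hGinj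
  have hhinj : Injective h := fun s t hst =>
    e₂.symm.injective (hmapinj (e₄.injective hst))
  have hhe : IsEmbedding h := (hhc.isClosedEmbedding hhinj).isEmbedding
  -- points `e₄ ↑u` with `u ∉ range G` are exactly the complement of `range h`
  have hrange : ∀ q : OnePoint (EuclideanSpace ℝ (Fin 4)),
      e₄ q ∈ range h ↔ q ∈ range (OnePoint.map G) := by
    intro q
    constructor
    · rintro ⟨s, hs⟩
      exact ⟨e₂.symm s, e₄.injective hs⟩
    · rintro ⟨p, rfl⟩
      exact ⟨e₂ p, by simp [h]⟩
  have hcoe_range : ∀ u : EuclideanSpace ℝ (Fin 4),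
      (↑u : OnePoint (EuclideanSpace ℝ (Fin 4))) ∈ range (OnePoint.map G) ↔ u ∈ range G := by
    intro u
    constructor
    · rintro ⟨p, hp⟩
      induction p using OnePoint.rec with
      | infty => exact absurd hp (by simp)
      | coe v => exact ⟨v, by simpa using hp⟩
    · rintro ⟨v, rfl⟩
      exact ⟨↑v, rfl⟩
  have hG_range : ∀ u : EuclideanSpace ℝ (Fin 4), u ∈ range G ↔
      (β₄ u : EuclideanSpace ℝ (Fin 4)) ∈ g '' Metric.closedBall 0 1 := by
    intro u
    constructor
    · rintro ⟨v, rfl⟩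
      refine ⟨β₂ v, ball_subset_closedBall (β₂ v).2, ?_⟩
      change g (β₂ v) = (β₄ (β₄.symm ⟨g (β₂ v), hball v⟩) : EuclideanSpace ℝ (Fin 4))
      rw [β₄.apply_symm_apply]
    · rintro ⟨x, hx, hxu⟩
      have hx1 : ‖x‖ < 1 := by
        rcases (mem_closedBall_zero_iff.1 hx).lt_or_eq with h1 | h1
        · exact h1
        · have := heq x h1
          rw [hxu] at this
          exact absurd this (ne_of_lt (mem_ball_zero_iff.1 (β₄ u).2))
      refine ⟨β₂.symm ⟨x, mem_ball_zero_iff.2 hx1⟩, ?_⟩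
      change β₄.symm ⟨g (β₂ (β₂.symm ⟨x, _⟩)), _⟩ = u
      rw [← β₄.symm_apply_apply u]
      congr 1
      apply Subtype.ext
      simp [hxu]
  -- the homeomorphism `sliceDiscExterior g ≃ₜ (range h)ᶜ`
  have hclos : closure (g '' Metric.closedBall (0 : EuclideanSpace ℝ (Fin 2)) 1) =
      g '' Metric.closedBall 0 1 :=
    ((isCompact_closedBall _ _).image_of_continuousOn hc).isClosed.closure_eq
  set cE : EuclideanSpace ℝ (Fin 4) ≃ₜ
      ↥(range ((↑) : EuclideanSpace ℝ (Fin 4) → OnePoint (EuclideanSpace ℝ (Fin 4)))) :=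
    OnePoint.isOpenEmbedding_coe.isEmbedding.toHomeomorph with hcE
  -- forward map
  have hy1 : ∀ y : sliceDiscExterior g,
      (y.1 : EuclideanSpace ℝ (Fin 4)) ∈ Metric.ball (0 : EuclideanSpace ℝ (Fin 4)) 1 :=
    fun y => mem_ball_zero_iff.2 (mem_sliceDiscExterior_iff.1 y.2).1
  have hfwd_mem : ∀ y : sliceDiscExterior g,
      e₄ (↑(β₄.symm ⟨y.1, hy1 y⟩) : OnePoint (EuclideanSpace ℝ (Fin 4))) ∈ (range h)ᶜ := by
    intro y
    rw [mem_compl_iff, hrange, hcoe_range, hG_range, β₄.apply_symm_apply]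
    exact fun hmem => (mem_sliceDiscExterior_iff.1 y.2).2 (subset_closure hmem)
  -- backward map: a point off `range h` is `e₄ ↑u` with `u ∉ range G`
  have hbwd_ne : ∀ p : ↥((range h)ᶜ), e₄.symm p.1 ≠ OnePoint.infty := by
    intro p hp
    apply p.2
    rw [← e₄.apply_symm_apply p.1, hrange, hp]
    exact ⟨OnePoint.infty, rfl⟩
  have hbwd_range : ∀ p : ↥((range h)ᶜ), e₄.symm p.1 ∈
      range ((↑) : EuclideanSpace ℝ (Fin 4) → OnePoint (EuclideanSpace ℝ (Fin 4))) := by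
    intro p
    exact OnePoint.ne_infty_iff_exists.1 (hbwd_ne p) |>.imp fun u hu => hu
  have hcE_symm : ∀ (q : OnePoint (EuclideanSpace ℝ (Fin 4)))
      (hq : q ∈ range ((↑) : EuclideanSpace ℝ (Fin 4) → OnePoint (EuclideanSpace ℝ (Fin 4))))
      (v : EuclideanSpace ℝ (Fin 4)), q = ↑v → cE.symm ⟨q, hq⟩ = v := by
    rintro q hq v rfl
    rw [hcE]
    exact IsEmbedding.toHomeomorph_symm_apply _ v
  have hbwd_coe : ∀ p : ↥((range h)ᶜ),
      (↑(cE.symm ⟨e₄.symm p.1, hbwd_range p⟩) : OnePoint (EuclideanSpace ℝ (Fin 4))) =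
        e₄.symm p.1 := by
    intro p
    obtain ⟨v, hv⟩ := hbwd_range p
    rw [hcE_symm _ (hbwd_range p) v hv.symm, hv]
  have hbwd_mem : ∀ p : ↥((range h)ᶜ),
      (β₄ (cE.symm ⟨e₄.symm p.1, hbwd_range p⟩) : EuclideanSpace ℝ (Fin 4)) ∈
        sliceDiscExterior g := by
    intro p
    rw [mem_sliceDiscExterior_iff, hclos, ← hG_range, ← hcoe_range, hbwd_coe, ← hrange,
      e₄.apply_symm_apply]
    exact ⟨mem_ball_zero_iff.1 (β₄ _).2, p.2⟩
  -- the two maps and the homeomorphism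
  let Φ : sliceDiscExterior g → ↥((range h)ᶜ) := fun y =>
    ⟨e₄ ↑(β₄.symm ⟨y.1, hy1 y⟩), hfwd_mem y⟩
  let Φinv : ↥((range h)ᶜ) → sliceDiscExterior g := fun p =>
    ⟨(β₄ (cE.symm ⟨e₄.symm p.1, hbwd_range p⟩) : EuclideanSpace ℝ (Fin 4)), hbwd_mem p⟩
  have hleft : ∀ y, Φinv (Φ y) = y := by
    intro y
    apply Subtype.ext
    show (β₄ (cE.symm ⟨e₄.symm (e₄ ↑(β₄.symm ⟨y.1, hy1 y⟩)), hbwd_range (Φ y)⟩) :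
      EuclideanSpace ℝ (Fin 4)) = y.1
    rw [hcE_symm _ (hbwd_range (Φ y)) (β₄.symm ⟨y.1, hy1 y⟩) (e₄.symm_apply_apply _),
      β₄.apply_symm_apply]
  have hright : ∀ p, Φ (Φinv p) = p := by
    intro p
    apply Subtype.ext
    show e₄ ↑(β₄.symm ⟨(β₄ (cE.symm ⟨e₄.symm p.1, hbwd_range p⟩) : EuclideanSpace ℝ (Fin 4)),
      hy1 (Φinv p)⟩) = p.1
    have h3 : (⟨(β₄ (cE.symm ⟨e₄.symm p.1, hbwd_range p⟩) : EuclideanSpace ℝ (Fin 4)),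
        hy1 (Φinv p)⟩ : ↥(Metric.ball (0 : EuclideanSpace ℝ (Fin 4)) 1)) =
          β₄ (cE.symm ⟨e₄.symm p.1, hbwd_range p⟩) :=
      Subtype.ext rfl
    rw [h3, β₄.symm_apply_apply, hbwd_coe, e₄.apply_symm_apply]
  have hΦc : Continuous Φ := by
    refine Continuous.subtype_mk ?_ _
    refine e₄.continuous.comp (OnePoint.continuous_coe.comp (β₄.symm.continuous.comp ?_))
    exact continuous_subtype_val.subtype_mk _
  have hΦinvc : Continuous Φinv := by
    refine Continuous.subtype_mk ?_ _
    refine continuous_subtype_val.comp (β₄.continuous.comp (cE.symm.continuous.comp ?_))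
    exact (e₄.symm.continuous.comp continuous_subtype_val).subtype_mk _
  exact ⟨h, hhe, ⟨⟨⟨Φ, Φinv, hleft, hright⟩, hΦc, hΦinvc⟩⟩⟩

/-- **The exterior of a continuous proper injective disc has no homology in degrees `≥ 2`**:
`Hᵢ(B̊⁴ ∖ g(𝔻²); M) = 0` for `i ≥ 2` (it is `S⁴ ∖ h(S²)` for a topological embedding `h`, and
Hatcher's Prop. 2B.1(b) gives `H̃ᵢ = 0` for `i ≠ 4 - 2 - 1 = 1`).
[cite: HatcherAT2002, Prop. 2B.1(b)] -/
theorem isZero_singularHomology_sliceDiscExterior_of_continuousOn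
    (hc : ContinuousOn g (Metric.closedBall (0 : EuclideanSpace ℝ (Fin 2)) 1))
    (hinj : InjOn g (Metric.closedBall (0 : EuclideanSpace ℝ (Fin 2)) 1))
    (hlt : ∀ x : EuclideanSpace ℝ (Fin 2), ‖x‖ < 1 → ‖g x‖ < 1)
    (heq : ∀ x : EuclideanSpace ℝ (Fin 2), ‖x‖ = 1 → ‖g x‖ = 1) (R : Type) [CommRing R]
    (M : Type) [AddCommGroup M] [Module R M] {i : ℕ} (hi : 2 ≤ i) :
    IsZero (singularHomology R M (sliceDiscExterior g) i) := by
  obtain ⟨h, he, ⟨Φ⟩⟩ :=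
    exists_isEmbedding_sphere_two_homeomorph_of_continuousOn hc hinj hlt heq
  have hz := SphereComplement.isZero_compl_range_of_isEmbedding_holds R M (k := 2) (n := 4)
    (i := i) h he (by norm_num) (by omega) (by omega)
  exact hz.of_iso (singularHomology.mapIso R M Φ i)

/-- **`H₁` of the exterior of a continuous proper injective disc is the coefficient module**:
`H₁(B̊⁴ ∖ g(𝔻²); M) ≅ M` (it is `S⁴ ∖ h(S²)`, Hatcher's Prop. 2B.1(b) in the degree
`4 - 2 - 1 = 1`). [cite: HatcherAT2002, Prop. 2B.1(b)] -/
theorem nonempty_singularHomology_sliceDiscExterior_one_iso_of_continuousOn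
    (hc : ContinuousOn g (Metric.closedBall (0 : EuclideanSpace ℝ (Fin 2)) 1))
    (hinj : InjOn g (Metric.closedBall (0 : EuclideanSpace ℝ (Fin 2)) 1))
    (hlt : ∀ x : EuclideanSpace ℝ (Fin 2), ‖x‖ < 1 → ‖g x‖ < 1)
    (heq : ∀ x : EuclideanSpace ℝ (Fin 2), ‖x‖ = 1 → ‖g x‖ = 1) (R : Type) [CommRing R]
    (M : Type) [AddCommGroup M] [Module R M] :
    Nonempty (singularHomology R M (sliceDiscExterior g) 1 ≅ ModuleCat.of R (ULift M)) := by
  obtain ⟨h, he, ⟨Φ⟩⟩ :=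
    exists_isEmbedding_sphere_two_homeomorph_of_continuousOn hc hinj hlt heq
  obtain ⟨e⟩ := SphereComplement.nonempty_compl_range_iso_coeff_of_isEmbedding R M (k := 2)
    (m := 3) h he (by norm_num)
  exact ⟨singularHomology.mapIso R M Φ 1 ≪≫ e⟩

end ProperDisc

/-! ### The core of a flat disc -/

namespace TopFlatDisc

variable {F : EuclideanSpace ℝ (Fin 2) × EuclideanSpace ℝ (Fin 2) → EuclideanSpace ℝ (Fin 4)}

/-- The core `x ↦ F (x, 0)` of a product neighbourhood which is a topological embedding on
`𝔻² × ℝ²` is continuous on the closed disc. [folklore] -/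
theorem continuousOn_core
    (hemb : IsEmbedding ((Metric.closedBall (0 : EuclideanSpace ℝ (Fin 2)) 1 ×ˢ
      (univ : Set (EuclideanSpace ℝ (Fin 2)))).restrict F)) :
    ContinuousOn (fun x ↦ F (x, 0)) (Metric.closedBall (0 : EuclideanSpace ℝ (Fin 2)) 1) := by
  have hF : ContinuousOn F (Metric.closedBall (0 : EuclideanSpace ℝ (Fin 2)) 1 ×ˢ
      (univ : Set (EuclideanSpace ℝ (Fin 2)))) :=
    continuousOn_iff_continuous_restrict.2 hemb.continuous
  exact hF.comp (continuousOn_id.prodMk continuousOn_const) fun x hx => ⟨hx, mem_univ _⟩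

/-- The core of a product neighbourhood which is an embedding on `𝔻² × ℝ²` is injective on the
closed disc. [folklore] -/
theorem injOn_core
    (hemb : IsEmbedding ((Metric.closedBall (0 : EuclideanSpace ℝ (Fin 2)) 1 ×ˢ
      (univ : Set (EuclideanSpace ℝ (Fin 2)))).restrict F)) :
    InjOn (fun x ↦ F (x, 0)) (Metric.closedBall (0 : EuclideanSpace ℝ (Fin 2)) 1) := by
  intro x hx y hy hxy
  have h := hemb.injective (a₁ := ⟨(x, 0), hx, mem_univ _⟩) (a₂ := ⟨(y, 0), hy, mem_univ _⟩)
    (by simpa using hxy)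
  simpa using congrArg (fun p : ↥(Metric.closedBall (0 : EuclideanSpace ℝ (Fin 2)) 1 ×ˢ
    (univ : Set (EuclideanSpace ℝ (Fin 2)))) => p.1.1) h

/-- The core of a flat disc maps the open disc into the open ball. [folklore] -/
theorem norm_core_lt_one
    (hnorm : ∀ x w : EuclideanSpace ℝ (Fin 2),
      ‖x‖ ≤ 1 → ‖F (x, w)‖ ≤ 1 ∧ (‖F (x, w)‖ = 1 ↔ ‖x‖ = 1))
    (x : EuclideanSpace ℝ (Fin 2)) (hx : ‖x‖ < 1) : ‖F (x, 0)‖ < 1 := by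
  obtain ⟨hle, hiff⟩ := hnorm x 0 hx.le
  exact lt_of_le_of_ne hle fun h ↦ hx.ne (hiff.mp h)

/-- The core of a flat disc maps the unit circle into the unit sphere. [folklore] -/
theorem norm_core_eq_one
    (hnorm : ∀ x w : EuclideanSpace ℝ (Fin 2),
      ‖x‖ ≤ 1 → ‖F (x, w)‖ ≤ 1 ∧ (‖F (x, w)‖ = 1 ↔ ‖x‖ = 1))
    (x : EuclideanSpace ℝ (Fin 2)) (hx : ‖x‖ = 1) : ‖F (x, 0)‖ = 1 :=
  (hnorm x 0 hx.le).2.mpr hx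

/-- **The exterior of a flat disc is `S⁴` minus an embedded `2`-sphere**: for a product
neighbourhood `F` as in `Knot.IsTopologicallySlice`, the open exterior `B̊⁴ ∖ F(𝔻² × {0})` of
its core disc is homeomorphic to the complement of a topologically embedded `S²` in `S⁴`.
[cite: ManolescuPiccirillo2023, §3.2, proof of Lemma 3.3; FreedmanQuinn1990, §9.3] -/
theorem exists_isEmbedding_sphere_two_homeomorph
    (hemb : IsEmbedding ((Metric.closedBall (0 : EuclideanSpace ℝ (Fin 2)) 1 ×ˢ
      (univ : Set (EuclideanSpace ℝ (Fin 2)))).restrict F))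
    (hnorm : ∀ x w : EuclideanSpace ℝ (Fin 2),
      ‖x‖ ≤ 1 → ‖F (x, w)‖ ≤ 1 ∧ (‖F (x, w)‖ = 1 ↔ ‖x‖ = 1)) :
    ∃ h : Metric.sphere (0 : EuclideanSpace ℝ (Fin 3)) 1 →
        Metric.sphere (0 : EuclideanSpace ℝ (Fin 5)) 1,
      IsEmbedding h ∧ Nonempty (sliceDiscExterior (fun x ↦ F (x, 0)) ≃ₜ ↥((range h)ᶜ)) :=
  exists_isEmbedding_sphere_two_homeomorph_of_continuousOn (continuousOn_core hemb)
    (injOn_core hemb) (norm_core_lt_one hnorm) (norm_core_eq_one hnorm)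

/-- **The exterior of a flat disc has no homology in degrees `≥ 2`**: `Hᵢ(B̊⁴ ∖ Δ; M) = 0` for
`i ≥ 2`, `Δ = F(𝔻² × {0})` the core of a product neighbourhood as in `Knot.IsTopologicallySlice`
(Alexander duality for the flat disc, via Hatcher's Prop. 2B.1(b); Livingston 2005, §6: the
topological locally flat category). [cite: HatcherAT2002, Prop. 2B.1(b)] -/
theorem isZero_singularHomology_sliceDiscExterior
    (hemb : IsEmbedding ((Metric.closedBall (0 : EuclideanSpace ℝ (Fin 2)) 1 ×ˢ
      (univ : Set (EuclideanSpace ℝ (Fin 2)))).restrict F))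
    (hnorm : ∀ x w : EuclideanSpace ℝ (Fin 2),
      ‖x‖ ≤ 1 → ‖F (x, w)‖ ≤ 1 ∧ (‖F (x, w)‖ = 1 ↔ ‖x‖ = 1))
    (R : Type) [CommRing R] (M : Type) [AddCommGroup M] [Module R M] {i : ℕ} (hi : 2 ≤ i) :
    IsZero (singularHomology R M (sliceDiscExterior fun x ↦ F (x, 0)) i) :=
  isZero_singularHomology_sliceDiscExterior_of_continuousOn (continuousOn_core hemb)
    (injOn_core hemb) (norm_core_lt_one hnorm) (norm_core_eq_one hnorm) R M hi

/-- **The exterior of a flat disc is a homology circle in degree one**: `H₁(B̊⁴ ∖ Δ; M) ≅ M` for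
the core `Δ = F(𝔻² × {0})` of a product neighbourhood as in `Knot.IsTopologicallySlice`
(Alexander duality for the flat disc, via Hatcher's Prop. 2B.1(b)).
[cite: HatcherAT2002, Prop. 2B.1(b)] -/
theorem nonempty_singularHomology_sliceDiscExterior_one_iso
    (hemb : IsEmbedding ((Metric.closedBall (0 : EuclideanSpace ℝ (Fin 2)) 1 ×ˢ
      (univ : Set (EuclideanSpace ℝ (Fin 2)))).restrict F))
    (hnorm : ∀ x w : EuclideanSpace ℝ (Fin 2),
      ‖x‖ ≤ 1 → ‖F (x, w)‖ ≤ 1 ∧ (‖F (x, w)‖ = 1 ↔ ‖x‖ = 1))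
    (R : Type) [CommRing R] (M : Type) [AddCommGroup M] [Module R M] :
    Nonempty (singularHomology R M (sliceDiscExterior fun x ↦ F (x, 0)) 1 ≅
      ModuleCat.of R (ULift M)) :=
  nonempty_singularHomology_sliceDiscExterior_one_iso_of_continuousOn (continuousOn_core hemb)
    (injOn_core hemb) (norm_core_lt_one hnorm) (norm_core_eq_one hnorm) R M

end TopFlatDisc

/-- **A topologically slice knot bounds a flat disc whose exterior is a homology circle**
(Livingston 2005, §2 with §6; the homological input of the Fox–Milnor condition in the
topological category): there is a product neighbourhood `F` as in `Knot.IsTopologicallySlice`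
whose core `Δ = F(𝔻² × {0})` bounds `K` and has `H₁(B̊⁴ ∖ Δ; M) ≅ M` and `Hᵢ(B̊⁴ ∖ Δ; M) = 0`
for `i ≥ 2`, for every coefficient module.
[cite: Livingston2005, §2 Thm. 2.6 and §6; HatcherAT2002, Prop. 2B.1(b)] -/
theorem Knot.IsTopologicallySlice.exists_core_homologyCircle {K : Knot}
    (hK : K.IsTopologicallySlice) (R : Type) [CommRing R] (M : Type) [AddCommGroup M]
    [Module R M] :
    ∃ F : EuclideanSpace ℝ (Fin 2) × EuclideanSpace ℝ (Fin 2) → EuclideanSpace ℝ (Fin 4),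
      IsEmbedding ((Metric.closedBall (0 : EuclideanSpace ℝ (Fin 2)) 1 ×ˢ
        (univ : Set (EuclideanSpace ℝ (Fin 2)))).restrict F) ∧
      (∀ x w : EuclideanSpace ℝ (Fin 2),
        ‖x‖ ≤ 1 → ‖F (x, w)‖ ≤ 1 ∧ (‖F (x, w)‖ = 1 ↔ ‖x‖ = 1)) ∧
      (∀ x : Metric.sphere (0 : EuclideanSpace ℝ (Fin 2)) 1, F (x, 0) = K x) ∧
      Nonempty (singularHomology R M (sliceDiscExterior fun x ↦ F (x, 0)) 1 ≅
        ModuleCat.of R (ULift M)) ∧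
      ∀ i : ℕ, 2 ≤ i →
        IsZero (singularHomology R M (sliceDiscExterior fun x ↦ F (x, 0)) i) := by
  obtain ⟨F, hemb, hnorm, hK⟩ := hK
  exact ⟨F, hemb, hnorm, hK,
    TopFlatDisc.nonempty_singularHomology_sliceDiscExterior_one_iso hemb hnorm R M,
    fun i hi => TopFlatDisc.isZero_singularHomology_sliceDiscExterior hemb hnorm R M hi⟩

end Literature.Topology.FourManifolds

end
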